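import Literature.MathematicalPhysics.QuantumFieldTheory.BalabanImbrieJaffe1984to88.BIJ88Eq5410Torus
import Literature.MathematicalPhysics.QuantumFieldTheory.BalabanImbrieJaffe1984to88.BIJ88Eq220Torus
import Literature.MathematicalPhysics.QuantumFieldTheory.BalabanImbrieJaffe1984to88.BIJ85Eq224Base0

/-!
# `BalabanImbrieJaffe1984to88.BIJ88Eq541Base0` — T. Bałaban, J. Imbrie, A. Jaffe, *Effective action and cluster properties of the abelian
Higgs model*, Commun. Math. Phys. **114** (1988) 257–315 [BalabanImbrieJaffe1988], Sect. 5.4 p. 281–283 [PDF 25–27]: **(5.4.1)** — *"We use the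
identity (2.20): Q^{s*}_kA′ − 𝒟_k∂*Q^{e*}_k∂A′ = H_kA′ + ∂C_kA′. (5.4.1)"* — DISCHARGED for the §5.4 torus chain: the hypothesis `h541` of
`BIJ88Eq542Torus.eq544_torus`/`eq546_torus` ((5.4.4), (5.4.6)) and of `BIJ88Eq5410Torus.eq549_torus`/`eq5410_torus` ((5.4.9), (5.4.10)) PROVED at
the torus model of record, base `0` (η-lattice `T_η = T^{(0)}`, unit lattice `T^{(k)}`), for the ACTUAL operators of (2.20) — so that (5.4.4),
(5.4.6), (5.4.9), (5.4.10) hold there with no hypothesis of the shape (5.4.1) (kind «model instance»).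

statement-level skeleton of published theorems with citation tags; proofs where landed; nothing here is a claim about the Yang–Mills mass gap

PDF held: `paper:balaban1988-cmp114-bij-abelian-higgs-effective-action` (journal page = PDF page + 256); p. 281 [PDF 25] (seat folder
`renders/original-p025-x2.png`), p. 282–283 [PDF 26–27] (`HOME/lit-balaban-r16/renders/cmp114/original-p026-x2.png`, `…-p027-x2.png`) read as
images this generation; p. 262 [PDF 6] ((2.20)–(2.22)) per p08 gen 7's `BIJ88Eq220Torus`.

CITATION HEADER (lean-in-tree rule).  Part of the lit-balaban TYPED SKELETON (HOME `run/shared/lean/pub/lit-balaban/`), PHASE-2 proof seat p31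
gen 7 (unit `lit-balaban-p31-g7`; TAKING line HOME/STATUS.md 2026-08-21T12:23Z; third file of the gen after `BIJ88Eq542Torus` p267565 and
`BIJ88Eq5410Torus` p268221).  WHAT IS REPRODUCED: rows `C2.Eq5.4.1-5.4.6` (member (5.4.1), and (5.4.4)/(5.4.6) made unconditional on it) and
`C2.Eq5.4.8-5.4.10` ((5.4.9)/(5.4.10) likewise) of `HOME/lit-balaban-r16/ROWS-C2-part2.md` (owner r16, referee ref-5).

THE PRINTED TEXT (verbatim).  p. 281: *"5.4. Gauge Transformation. We wish to keep H_k in the Landau gauge, and to accomplish this we follow [2]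
and make a background field dependent gauge transformation. We use the identity (2.20): Q^{s*}_kA′ − 𝒟_k∂*Q^{e*}_k∂A′ = H_kA′ + ∂C_kA′. (5.4.1)
Some care is needed because C_k is a nonlocal operator"*; p. 262: *"Another important kernel is the one generating the gauge transformation:
(Q^{s*}_k − 𝒟_k∂*Q^{e*}_k∂)A = H_kA + ∂C_kA. (2.20)"*; p. 282: *"The nonlocal gauge transformation (5.4.1) is now applied and we have (Q^{s*}_k −
𝒟_{k,loc}∂*Q^{e*}_k∂)□A′ = (H_k + ∂C_k)□A′ + w′₁A′ = H_{k,loc}A′ + ∂C_k□A′ + w₁A′. (5.4.4)"*, (5.4.6); p. 283: (5.4.9), (5.4.10) (quoted in full in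
the companions `BIJ88Eq542Torus`, `BIJ88Eq5410Torus`).

THE OPERATORS OF RECORD (all in the tree; one torus `P` of `Balaban1983to89.Setup`, standing range `k ≤ m + K`, `2 ≤ d`, weight `w > 0` of the
Euclidean carriers, lattice factor `c = η⁻¹` with `ηL^k = 1`).  (2.20) is PROVED on the tori by p08 gen 7 (`BIJ88Eq220Torus.eq220_torus_apply`, from
(I.5.3.1), (I.5.2.6)–(I.5.2.7), (2.21)) for: `Q^{s*}_k = BIJ85Prop521Torus.QsE P k` (p30's composite `BIJ85Eq531Inputs.QsstarIter k` between the
Euclidean carriers `CoarseSpace P k = EuclideanSpace ℝ (PBond P k)` and `BondSpace P = EuclideanSpace ℝ (PBond P 0)`), `𝒟_k = BIJ85Prop522Torus.DkE`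
((I.4.4.4), p11), `∂* = LinearMap.adjoint (BIJ85AxialPropagator411.curlOp w c)` (p09), `Q^{e*}_k = BIJ85Sigma421Torus.QesOp` (p30), `∂` on `T^{(k)}` =
`BIJ85Eq611Torus.dOne P k c` (curl with factor `c/L^k`), `H_k = BIJ85Prop522Torus.HkE` (Landau minimizer (I.4.4.2)), `C_k = BIJ88Eq220Torus.CkE`
((2.22) verbatim, p08), `∂` on gauge functions = `BIJ85LandauMinimizer442V1.gradV1 P c`.  The §5.4 torus chain (this seat, gens 6–7) speaks PLAIN
function carriers: `Q^{s*}_k = (BIJ85Eq224Proof.torusBlockBondsIter P i k).Qsstar : (PBond P (i+k) → ℝ) → (PBond P i → ℝ)`, `∂ =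
LatticeFieldCalculus.curl 1`, `∂^η = LatticeFieldCalculus.grad η⁻¹`, and linear-map DATA `T_k`, `H_k`, `C_k`.

WHAT IS PROVED (0 `sorry`, standard axioms; no `Prop`-valued fact introduced).
* §1 the three (2.20)-operators READ ON PLAIN CARRIERS (definitions with bodies = conjugation of the operators of record by the `WithLp`
  identifications `toE`/`toEj`/`toU`): **`TkF P hd w η k = 𝒟_k∂*Q^{e*}_k`** `: (Plaq P k → ℝ) →ₗ (PBond P 0 → ℝ)`, **`HkF P w η k = H_k`**,
  **`CkF P hd w η k = C_k`** `: (PBond P k → ℝ) →ₗ (Site P 0 → ℝ)` (lattice factor `c = η⁻¹`), with `rfl` unfoldings `TkF_apply`, `HkF_apply`,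
  `CkF_apply`; the component reading `QsE_toEj_apply` (`(Q^{s*}_kι_kA)(b) = (QsstarIter k A)(b)`; `∂ι_kA = ι(curl (c/L^k) A)` is
  `BIJ85Eq611Torus.dOne_toEj`, `∂^η` componentwise is `BIJ85LandauMinimizer442V1.gradV1_apply`).
* §2 **`QsstarTo_eq_QsstarIter`** / **`Qsstar_base0`**: at base `0` the k-fold block-bond geometry of the §5.3–§5.6 torus files IS p30's composite —
  `(torusBlockBondsIter P 0 k).Qsstar B = QsstarIter (0 + k) B` (named-level transport of this seat's gen-2 `BIJ85Eq224Base0.QsstarIter_eq`; Lean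
  spells the coarse level of `torusBlockBondsIter P 0 k` as `0 + k`, which it does not identify with `k` definitionally — every base-0 statement
  below therefore carries the level `0 + k`, and holds verbatim for each numeral `k`).
* §3 **(2.20) = (5.4.1) ON PLAIN CARRIERS**: **`eq220_plain`** — for every `A : PBond P k → ℝ` and η-bond `b`, `(QsstarIter k A)(b) − (T_k(∂A))(b) =
  (H_kA)(b) + (∂^η(C_kA))(b)` with `T_k = TkF`, `H_k = HkF`, `C_k = CkF`, `∂ = curl 1` (`ηL^k = 1` turns `dOne`'s factor `η⁻¹/L^k` into `1`),
  `∂^η = grad η⁻¹` — p08's `eq220_torus_apply` read componentwise; **`eq541_base0`**: the same for `(torusBlockBondsIter P 0 k).Qsstar`, i.e. EXACTLY the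
  hypothesis `h541` of the four §5.4 torus theorems at `i = 0`.
* §4 the four displays UNCONDITIONAL ON (5.4.1) at base 0: **`eq544_base0`** ((5.4.3)–(5.4.4)), **`eq546_base0`** ((5.4.5) → (5.4.6)), **`eq549_base0`**
  ((5.4.9)), **`eq5410_base0`** ((5.4.10)) — the companions' `eq544_torus`, `eq546_torus`, `eq549_torus`, `eq5410_torus` with `T_k, H_k, C_k := TkF, HkF,
  CkF` and `h541 := eq541_base0`; what stays data/hypothesis is exactly what is data in print at this point: the LOCALIZED kernels `T_loc =
  𝒟_{k,loc}∂*Q^{e*}_k`, `H_{k,loc}` (the localized kernels of Sect. 2's expansions — p. 282: *"The kernel w′₁ = (𝒟_k − 𝒟_{k,loc})∂*Q^{e*}_k∂□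
  involves only the tails not included in the expansion (2.12)"* — whose construction is not formalized in the tree), `Q^{e*}_{k+1}` on the
  `f`-slot (`Qes`), the (5.3.4) locality `hT`, the p. 281 collar ∕ range hypotheses (`hdep`, `hrange`; mechanism theorems in the companions).
HONEST SCOPE.  Base `0` only (p08's Euclidean carriers put the η-lattice at torus level `0`; the companions' theorems hold at every base `i`).  One
torus at a time; nothing on the decay (2.23)–(2.26) of `H_k`, `C_k`, on `w₁`/`w₅` smallness (p08 gen 4 `BIJ88Ineq547W1Prime`, `BIJ88W5Bound549`), or on
the later removal of `w₅A′`.  NOT summit progress.  Imports: this seat's `BIJ88Eq5410Torus` (p268221) and `BIJ85Eq224Base0` (p247089), p08 gen 7's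
`BIJ88Eq220Torus` (p255966).  Unit `lit-balaban-p31` (literature-prover-lit-balaban-p31-g7-0), 2026-08-21.
-/

namespace Literature.MathematicalPhysics.QuantumFieldTheory.BalabanImbrieJaffe1984to88.BIJ88Eq541Base0

open Literature.MathematicalPhysics.QuantumFieldTheory.Balaban1983to89
open BIJ88Sect3Statements (U1 toC starB starP)
open BIJ88Sect4Statements (backgroundU bgGaugeU)
open BIJ88Sect5StatementsPart3 (bgExp)
open BIJ85BlockAveragesTorus (expU1 surfMul)
open BIJ85Eq453GaugeField (qsstarGIter)
open BIJ85Eq224Proof (torusBlockBondsIter)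
open BIJ85Eq224Base0 (torusBlockBondsTo QsstarIter_eq)
open BIJ85Eq531Inputs (QsstarIter)
open BIJ85AxialPropagator411 (BondSpace toE curlOp)
open BIJ85Prop521Torus (CoarseSpace toEj QsE QsE_apply)
open BIJ85Sigma421Torus (UnitPlaqSpace toU QesOp)
open BIJ85Eq611Torus (dOne dOne_toEj)
open BIJ85Prop522Torus (DkE HkE)
open BIJ85LandauMinimizer442V1 (gradV1 gradV1_apply)
open BIJ88Eq220Torus (CkE eq220_torus_apply)
open BIJ88Eq536Linearization (cutoff)
open BIJ88Eq533Torus (cutoffG blockUnion)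
open BIJ88Eq542Torus (eq544_torus eq546_torus)
open BIJ88Eq5410Torus (eq549_torus eq5410_torus)
open LatticeFieldCalculus (grad curl)
open scoped BigOperators Real
open Complex Finset

variable {P : Params}

/-! ## §1 The operators of (2.20) = (5.4.1) read on plain function carriers -/

section
variable (P)

/-- **`T_k = 𝒟_k∂*Q^{e*}_k`** of (5.4.1)–(5.4.3) — *"Q^{s*}_kA′ − 𝒟_k∂*Q^{e*}_k∂A′"* — as a linear map from unit-lattice plaquette functions
(`T^{(k)}`) to η-lattice bond functions (`T^{(0)}`): the operators of record `𝒟_k = DkE` ((I.4.4.4)), `∂* = (curlOp w c)†`, `Q^{e*}_k = QesOp`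
(weight `w`, lattice factor `c = η⁻¹`) conjugated by the `WithLp` identifications. [cite: BalabanImbrieJaffe1988, (5.4.1) p.281] -/
noncomputable def TkF (hd : 2 ≤ P.d) (w η : ℝ) (k : ℕ) : (Balaban1983to89.Plaq P k → ℝ) →ₗ[ℝ] (PBond P 0 → ℝ) :=
  (toE P).symm.toLinearMap ∘ₗ
    (DkE P w η⁻¹ k ∘ₗ LinearMap.adjoint (curlOp (P := P) w η⁻¹) ∘ₗ QesOp (P := P) hd w k) ∘ₗ (toU P k).toLinearMap

/-- **`H_k`** of (5.4.1) (the Landau-gauge minimizer, *"We wish to keep H_k in the Landau gauge"*) as a linear map from unit-lattice bond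
functions to η-lattice bond functions: the operator of record `HkE P w c k` ((I.4.4.2)), `c = η⁻¹`, conjugated by the `WithLp` identifications.
[cite: BalabanImbrieJaffe1988, (5.4.1) p.281] -/
noncomputable def HkF (w η : ℝ) (k : ℕ) : (PBond P k → ℝ) →ₗ[ℝ] (PBond P 0 → ℝ) :=
  (toE P).symm.toLinearMap ∘ₗ HkE P w η⁻¹ k ∘ₗ (toEj P k).toLinearMap

/-- **`C_k`** of (5.4.1) (*"Some care is needed because C_k is a nonlocal operator"*; (2.22)) as a linear map from unit-lattice bond functions
to η-lattice gauge functions: p08's operator of record `BIJ88Eq220Torus.CkE P hd w c k` ((2.22) verbatim), `c = η⁻¹`, conjugated by the `WithLp`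
identifications. [cite: BalabanImbrieJaffe1988, (5.4.1) p.281] -/
noncomputable def CkF (hd : 2 ≤ P.d) (w η : ℝ) (k : ℕ) : (PBond P k → ℝ) →ₗ[ℝ] (Balaban1983to89.Site P 0 → ℝ) :=
  (WithLp.linearEquiv 2 ℝ (Balaban1983to89.Site P 0 → ℝ)).toLinearMap ∘ₗ CkE P hd w η⁻¹ k ∘ₗ (toEj P k).toLinearMap

end

/-- Unfolding `T_k` componentwise. [cite: BalabanImbrieJaffe1988, (5.4.1) p.281] -/
theorem TkF_apply (hd : 2 ≤ P.d) (w η : ℝ) (k : ℕ) (F : Balaban1983to89.Plaq P k → ℝ) (b : PBond P 0) :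
    TkF P hd w η k F b = DkE P w η⁻¹ k (LinearMap.adjoint (curlOp (P := P) w η⁻¹) (QesOp (P := P) hd w k (toU P k F))) b := rfl

/-- Unfolding `H_k` componentwise. [cite: BalabanImbrieJaffe1988, (5.4.1) p.281] -/
theorem HkF_apply (w η : ℝ) (k : ℕ) (A : PBond P k → ℝ) (b : PBond P 0) : HkF P w η k A b = HkE P w η⁻¹ k (toEj P k A) b := rfl

/-- Unfolding `C_k` componentwise. [cite: BalabanImbrieJaffe1988, (5.4.1) p.281] -/
theorem CkF_apply (hd : 2 ≤ P.d) (w η : ℝ) (k : ℕ) (A : PBond P k → ℝ) (x : Balaban1983to89.Site P 0) :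
    CkF P hd w η k A x = CkE P hd w η⁻¹ k (toEj P k A) x := rfl

/-- kernel: the Euclidean `Q^{s*}_k` of record read componentwise IS p30's composite on functions: `(Q^{s*}_kι_kA)(b) = (QsstarIter k A)(b)`.
[cite: BalabanImbrieJaffe1988, (5.4.1) p.281] -/
theorem QsE_toEj_apply (k : ℕ) (A : PBond P k → ℝ) (b : PBond P 0) : QsE P k (toEj P k A) b = QsstarIter k A b := by
  rw [QsE_apply, LinearEquiv.symm_apply_apply]
  rfl

/-! ## §2 At base `0` the k-fold block-bond geometry is p30's composite `Q^{s*}_k = (Q^{s*})^k` -/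

/-- kernel (named coarse level): for `h : 0 + k = n`, the pull-back of the base-0 k-fold geometry with coarse level `n` IS p30's composite
`QsstarIter n` (transport of this seat's `BIJ85Eq224Base0.QsstarIter_eq` along `k = n`; standing range). [cite: BalabanImbrieJaffe1988, (5.4.1) p.281] -/
theorem QsstarTo_eq_QsstarIter {k n : ℕ} (h : 0 + k = n) (hn : n ≤ P.m + P.K) (B : PBond P n → ℝ) :
    (torusBlockBondsTo P 0 k n h).Qsstar B = QsstarIter n B := by
  have e : k = n := (Nat.zero_add k).symm.trans h
  subst e
  exact (QsstarIter_eq k hn B).symm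

/-- **Base 0**: the real pull-back `Q^{s*}_k` of the §5.3–§5.6 torus files at base `0`, `(torusBlockBondsIter P 0 k).Qsstar` (coarse level spelled
`0 + k` by Lean), IS p30's composite `QsstarIter (0 + k)` (standing range). [cite: BalabanImbrieJaffe1988, (5.4.1) p.281] -/
theorem Qsstar_base0 {k : ℕ} (hk : 0 + k ≤ P.m + P.K) (B : PBond P (0 + k) → ℝ) :
    (torusBlockBondsIter P 0 k).Qsstar B = QsstarIter (0 + k) B :=
  QsstarTo_eq_QsstarIter rfl hk B

/-! ## §3 (2.20) = (5.4.1) on plain carriers -/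

/-- **(5.4.1) = (2.20) ON PLAIN FUNCTION CARRIERS** (p08 gen 7's torus theorem `BIJ88Eq220Torus.eq220_torus_apply` read componentwise).  For the
torus `P`, `k ≤ m + K`, `2 ≤ d`, weight `w > 0` and `η` with `ηL^k = 1` (so that the lattice factor of record `c = η⁻¹` gives `dOne`'s unit-lattice
curl the factor `η⁻¹/L^k = 1`): for every unit-lattice bond function `A` and every η-bond `b`,
`(Q^{s*}_kA)(b) − (T_k(∂A))(b) = (H_kA)(b) + (∂^η(C_kA))(b)` with `Q^{s*}_k = QsstarIter k`, `T_k = TkF`, `H_k = HkF`, `C_k = CkF`, `∂ = curl 1`,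
`∂^η = grad η⁻¹`. [cite: BalabanImbrieJaffe1988, (5.4.1) p.281] -/
theorem eq220_plain (hd : 2 ≤ P.d) {k : ℕ} (hk : k ≤ P.m + P.K) {η : ℝ} (hη : η * (P.L : ℝ) ^ k = 1) {w : ℝ} (hw : 0 < w)
    (A : PBond P k → ℝ) (b : PBond P 0) :
    QsstarIter k A b - TkF P hd w η k (curl 1 A) b = HkF P w η k A b + grad η⁻¹ (CkF P hd w η k A) b := by
  have hL : ((P.L : ℝ) ^ k) ≠ 0 := pow_ne_zero _ (by exact_mod_cast P.L_pos.ne')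
  have hηinv : η⁻¹ = (P.L : ℝ) ^ k := inv_eq_of_mul_eq_one_right hη
  have hη0 : η ≠ 0 := by
    rintro rfl
    rw [zero_mul] at hη
    exact zero_ne_one hη
  have h1 : η⁻¹ / (P.L : ℝ) ^ k = 1 := by rw [hηinv, div_self hL]
  have h220 := eq220_torus_apply hd hk (inv_ne_zero hη0) hw (toEj P k A)
  rw [dOne_toEj, h1] at h220
  have hb := congrArg (fun v : BondSpace P => v b) h220
  simp only [PiLp.sub_apply, PiLp.add_apply, gradV1_apply, QsE_toEj_apply] at hb
  exact hb

/-- **(5.4.1) AT BASE 0 FOR THE §5.4 TORUS CHAIN**: exactly the hypothesis `h541` of `BIJ88Eq542Torus.eq544_torus`/`eq546_torus` and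
`BIJ88Eq5410Torus.eq549_torus`/`eq5410_torus` at `i = 0`, for `T_k, H_k, C_k := TkF, HkF, CkF` at the level `0 + k` of `torusBlockBondsIter P 0 k`:
`(Q^{s*}_kA)(b) − (T_k(∂A))(b) = (H_kA)(b) + (∂^η(C_kA))(b)` for every `A`, `b` (standing range, `ηL^k = 1`, `w > 0`, `2 ≤ d`).
[cite: BalabanImbrieJaffe1988, (5.4.1) p.281] -/
theorem eq541_base0 (hd : 2 ≤ P.d) {k : ℕ} (hk : 0 + k ≤ P.m + P.K) {η : ℝ} (hη : η * (P.L : ℝ) ^ k = 1) {w : ℝ} (hw : 0 < w)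
    (A : PBond P (0 + k) → ℝ) (b : PBond P 0) :
    (torusBlockBondsIter P 0 k).Qsstar A b - TkF P hd w η (0 + k) (curl 1 A) b =
      HkF P w η (0 + k) A b + grad η⁻¹ (CkF P hd w η (0 + k) A) b := by
  have hη' : η * (P.L : ℝ) ^ (0 + k) = 1 := by rwa [Nat.zero_add]
  rw [Qsstar_base0 hk]
  exact eq220_plain hd hk hη' hw A b

/-! ## §4 (5.4.4), (5.4.6), (5.4.9), (5.4.10) at base 0, unconditional on (5.4.1) -/

/-- **(5.4.3)–(5.4.4) AT THE TORUS MODEL OF RECORD, base 0, (5.4.1) discharged** (`BIJ88Eq542Torus.eq544_torus` with `h541 := eq541_base0`): for the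
ACTUAL `Q^{s*}_k`, `T_k = 𝒟_k∂*Q^{e*}_k`, `H_k`, `C_k` and localized kernels `T_loc`, `H_{k,loc}` (data), at every η-bond,
`(Q^{s*}_k − T_loc∂)(□A′) = H_{k,loc}A′ + ∂^ηC_k(□A′) + w₁A′`, `w₁A′ = (T_k − T_loc)∂(□A′) + H_k(□A′) − H_{k,loc}A′` (`□` = a unit-lattice bond set `Bx`;
level `0 + k` = the unit lattice). [cite: BalabanImbrieJaffe1988, (5.4.4) p.282] -/
theorem eq544_base0 (hd : 2 ≤ P.d) {k : ℕ} (hk : k ≤ P.m + P.K) {η : ℝ} (hη : η * (P.L : ℝ) ^ k = 1) {w : ℝ} (hw : 0 < w)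
    (Tloc : (Balaban1983to89.Plaq P (0 + k) → ℝ) →ₗ[ℝ] (PBond P 0 → ℝ)) (Hloc : (PBond P (0 + k) → ℝ) →ₗ[ℝ] (PBond P 0 → ℝ))
    (Bx : Finset (PBond P (0 + k))) (A' : PBond P (0 + k) → ℝ) (b : PBond P 0) :
    (torusBlockBondsIter P 0 k).Qsstar ((↑Bx : Set (PBond P (0 + k))).indicator A') b -
        Tloc (curl 1 ((↑Bx : Set (PBond P (0 + k))).indicator A')) b =
      Hloc A' b + grad η⁻¹ (CkF P hd w η (0 + k) ((↑Bx : Set (PBond P (0 + k))).indicator A')) b +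
        ((TkF P hd w η (0 + k) (curl 1 ((↑Bx : Set (PBond P (0 + k))).indicator A')) b -
            Tloc (curl 1 ((↑Bx : Set (PBond P (0 + k))).indicator A')) b) +
          (HkF P w η (0 + k) ((↑Bx : Set (PBond P (0 + k))).indicator A') b - Hloc A' b)) :=
  eq544_torus (TkF P hd w η (0 + k)) Tloc (HkF P w η (0 + k)) Hloc (CkF P hd w η (0 + k)) (eq541_base0 hd (by omega) hη hw) Bx A' b

/-- **(5.4.5) → (5.4.6) AT THE TORUS MODEL OF RECORD, base 0, (5.4.1) discharged** (`BIJ88Eq542Torus.eq546_torus` with `h541 := eq541_base0`): at a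
bond `b ∈ □₀ ∩ Λ̄₁^{(k)*}`, under the (5.3.4) locality `hT` and the p. 281 range hypothesis `hdep` for `T_loc`, the background gauge transformation
with `λ = Λ̄₃·C_k(□A′)` — `C_k` the ACTUAL (2.22) operator — turns `u_k` into `(Q^{s*}_{k+1}v)(b) · exp ie_kη[H_{k,loc}A′ + ∂^η(Λ̄₃ᶜ·C_k(□A′)) + w₁A′ −
L^{−2}T_loc(Q^{e*}f)](b)`, `w₁A′` as in `eq544_base0` (η-lattice = level `0`, unit lattice = level `0 + k`, blocks = level `0 + k + 1`).
[cite: BalabanImbrieJaffe1988, (5.4.6) p.282] -/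
theorem eq546_base0 (hd : 2 ≤ P.d) {k : ℕ} (hk : k + 1 ≤ P.m + P.K) {ek η : ℝ} (hη : η * (P.L : ℝ) ^ k = 1) {w : ℝ} (hw : 0 < w)
    (X : Finset (Balaban1983to89.Site P (0 + k + 1))) {u' : GaugeField P (0 + k) U1} {A' : PBond P (0 + k) → ℝ}
    (hu : ∀ c ∈ starB (blockUnion 1 X), u' c = expU1 (ek * A' c)) (v : GaugeField P (0 + k + 1) U1) (g : PBond P 0 → ℝ)
    {Plc : Type*} (L : ℝ) (Tloc : (Balaban1983to89.Plaq P (0 + k) → ℝ) →ₗ[ℝ] (PBond P 0 → ℝ))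
    (Hloc : (PBond P (0 + k) → ℝ) →ₗ[ℝ] (PBond P 0 → ℝ)) (Qes : (Plc → ℝ) →ₗ[ℝ] (Balaban1983to89.Plaq P (0 + k) → ℝ)) (f : Plc → ℝ)
    (Xb X₀ : Finset (Balaban1983to89.Site P (0 + k))) (hX₀ : X₀ ⊆ Xb) (S₃ : Finset (Balaban1983to89.Site P 0))
    {b : PBond P 0} (hb₁ : b ∈ starB (blockUnion (k + 1) X)) (hb₀ : b ∈ starB (blockUnion k X₀))
    (hT : g b = Tloc (curl 1 A' + L⁻¹ ^ 2 • Qes f) b)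
    (hdep : ∀ F₁ F₂ : Balaban1983to89.Plaq P (0 + k) → ℝ, (∀ p ∈ starP Xb, F₁ p = F₂ p) → Tloc F₁ b = Tloc F₂ b) :
    bgGaugeU ek η ((↑S₃ : Set (Balaban1983to89.Site P 0)).indicator
          (CkF P hd w η (0 + k) ((↑(starB Xb) : Set (PBond P (0 + k))).indicator A')))
        (backgroundU ek η (fun b => toC (qsstarGIter k (surfMul u' (cutoff (starB X) v)) b)) g) b =
      bgExp ek η (fun b => toC (qsstarGIter (k + 1) v b))
        (fun b => Hloc A' b + grad η⁻¹ ((↑S₃ᶜ : Set (Balaban1983to89.Site P 0)).indicator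
            (CkF P hd w η (0 + k) ((↑(starB Xb) : Set (PBond P (0 + k))).indicator A'))) b +
          ((TkF P hd w η (0 + k) (curl 1 ((↑(starB Xb) : Set (PBond P (0 + k))).indicator A')) b -
              Tloc (curl 1 ((↑(starB Xb) : Set (PBond P (0 + k))).indicator A')) b) +
            (HkF P w η (0 + k) ((↑(starB Xb) : Set (PBond P (0 + k))).indicator A') b - Hloc A' b)) -
          L⁻¹ ^ 2 * Tloc (Qes f) b) b :=
  eq546_torus (by omega) hη X hu v g L (TkF P hd w η (0 + k)) Tloc (HkF P w η (0 + k)) Hloc (CkF P hd w η (0 + k))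
    (eq541_base0 hd (by omega) hη hw) Qes f Xb X₀ hX₀ S₃ hb₁ hb₀ hT hdep

/-- **(5.4.9) AT THE TORUS MODEL OF RECORD, base 0, (5.4.1) discharged** (`BIJ88Eq5410Torus.eq549_torus` with `h541 := eq541_base0`): for the ACTUAL
`Q^{s*}_k`, `T_k`, `H_k`, `C_k`, data `T_loc`, `H_{k,loc}`, a unit-lattice bond set `S = Λ₃^{(k)*}`, an η-bond set `Λ₂s = Λ̄₂^{(k)*}` and the range law
`hrange`, at every η-bond: `Λ̄₂*(Q^{s*}_k − T_loc∂)A′ = Λ̄₂*(Q^{s*}_k − T_loc∂)(Λ₃^{*c}A′) + H_{k,loc}(Λ₃*A′) + ∂^ηC_k(Λ₃*A′) + w₅A′`, `w₅A′ = (T_k −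
T_loc)∂(Λ₃*A′) + (H_k − H_{k,loc})(Λ₃*A′)` (r16's corrected sign). [cite: BalabanImbrieJaffe1988, (5.4.9) p.283] -/
theorem eq549_base0 (hd : 2 ≤ P.d) {k : ℕ} (hk : k ≤ P.m + P.K) {η : ℝ} (hη : η * (P.L : ℝ) ^ k = 1) {w : ℝ} (hw : 0 < w)
    (Tloc : (Balaban1983to89.Plaq P (0 + k) → ℝ) →ₗ[ℝ] (PBond P 0 → ℝ)) (Hloc : (PBond P (0 + k) → ℝ) →ₗ[ℝ] (PBond P 0 → ℝ))
    (S : Finset (PBond P (0 + k))) (Λ₂s : Finset (PBond P 0)) (A' : PBond P (0 + k) → ℝ)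
    (hrange : ∀ b ∉ Λ₂s, (torusBlockBondsIter P 0 k).Qsstar ((↑S : Set (PBond P (0 + k))).indicator A') b -
      Tloc (curl 1 ((↑S : Set (PBond P (0 + k))).indicator A')) b = 0) (b : PBond P 0) :
    (↑Λ₂s : Set (PBond P 0)).indicator (fun b => (torusBlockBondsIter P 0 k).Qsstar A' b - Tloc (curl 1 A') b) b =
      (↑Λ₂s : Set (PBond P 0)).indicator (fun b => (torusBlockBondsIter P 0 k).Qsstar ((↑Sᶜ : Set (PBond P (0 + k))).indicator A') b -
          Tloc (curl 1 ((↑Sᶜ : Set (PBond P (0 + k))).indicator A')) b) b +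
        (Hloc ((↑S : Set (PBond P (0 + k))).indicator A') b +
            grad η⁻¹ (CkF P hd w η (0 + k) ((↑S : Set (PBond P (0 + k))).indicator A')) b +
          ((TkF P hd w η (0 + k) (curl 1 ((↑S : Set (PBond P (0 + k))).indicator A')) b -
              Tloc (curl 1 ((↑S : Set (PBond P (0 + k))).indicator A')) b) +
            (HkF P w η (0 + k) ((↑S : Set (PBond P (0 + k))).indicator A') b -
              Hloc ((↑S : Set (PBond P (0 + k))).indicator A') b))) :=
  eq549_torus (by omega) (TkF P hd w η (0 + k)) Tloc (HkF P w η (0 + k)) Hloc (CkF P hd w η (0 + k)) (eq541_base0 hd (by omega) hη hw)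
    S Λ₂s A' hrange b

/-- **(5.4.10) AT THE TORUS MODEL OF RECORD, base 0, (5.4.1) discharged** (`BIJ88Eq5410Torus.eq5410_torus` with `h541 := eq541_base0`): the
background gauge transformation with the NONLOCAL `λ = C_k(Λ₃*A′)` — `C_k` the ACTUAL (2.22) operator — applied to (5.4.8) gives, at EVERY η-bond,
`(Λ̄₂^{*c}u_k)(Λ̄₂^{*}Q^{s*}_{k+1}v) exp ie_kη[Λ̄₂^{*}(Q^{s*}_k − T_loc∂)(Λ₃^{*c}A′) − L^{−2}Λ̄₂^{*}T_loc(Q^{e*}f) + H_{k,loc}(Λ₃*A′) + w₅A′]`, `w₅A′` as in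
`eq549_base0`; data/hypotheses: `T_loc`, `H_{k,loc}`, `Qes`, the (5.3.4) locality `hT` on `Λ̄₂*`, the range law `hrange`.
[cite: BalabanImbrieJaffe1988, (5.4.10) p.283] -/
theorem eq5410_base0 (hd : 2 ≤ P.d) {k : ℕ} (hk : k + 1 ≤ P.m + P.K) {ek η : ℝ} (hη : η * (P.L : ℝ) ^ k = 1) {w : ℝ} (hw : 0 < w)
    (X : Finset (Balaban1983to89.Site P (0 + k + 1))) {u' : GaugeField P (0 + k) U1} {A' : PBond P (0 + k) → ℝ}
    (hu : ∀ c ∈ starB (blockUnion 1 X), u' c = expU1 (ek * A' c)) (v : GaugeField P (0 + k + 1) U1) (g : PBond P 0 → ℝ)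
    {Plc : Type*} (L : ℝ) (Tloc : (Balaban1983to89.Plaq P (0 + k) → ℝ) →ₗ[ℝ] (PBond P 0 → ℝ))
    (Hloc : (PBond P (0 + k) → ℝ) →ₗ[ℝ] (PBond P 0 → ℝ)) (Qes : (Plc → ℝ) →ₗ[ℝ] (Balaban1983to89.Plaq P (0 + k) → ℝ)) (f : Plc → ℝ)
    (X₂ : Finset (Balaban1983to89.Site P (0 + k + 1))) (hX₂ : X₂ ⊆ X)
    (hT : ∀ b ∈ starB (blockUnion (k + 1) X₂), g b = Tloc (curl 1 A' + L⁻¹ ^ 2 • Qes f) b)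
    (S : Finset (PBond P (0 + k)))
    (hrange : ∀ b ∉ starB (blockUnion (k + 1) X₂), (torusBlockBondsIter P 0 k).Qsstar ((↑S : Set (PBond P (0 + k))).indicator A') b -
      Tloc (curl 1 ((↑S : Set (PBond P (0 + k))).indicator A')) b = 0) (b : PBond P 0) :
    bgGaugeU ek η (CkF P hd w η (0 + k) ((↑S : Set (PBond P (0 + k))).indicator A'))
        (backgroundU ek η (fun b => toC (qsstarGIter k (surfMul u' (cutoff (starB X) v)) b)) g) b =
      cutoffG (starB (blockUnion (k + 1) X₂))ᶜ
          (backgroundU ek η (fun b => toC (qsstarGIter k (surfMul u' (cutoff (starB X) v)) b)) g) b *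
        toC (cutoffG (starB (blockUnion (k + 1) X₂)) (qsstarGIter (k + 1) v) b) *
        Complex.exp (I * ((ek * η *
          ((↑(starB (blockUnion (k + 1) X₂)) : Set (PBond P 0)).indicator
              (fun b => (torusBlockBondsIter P 0 k).Qsstar ((↑Sᶜ : Set (PBond P (0 + k))).indicator A') b -
                Tloc (curl 1 ((↑Sᶜ : Set (PBond P (0 + k))).indicator A')) b) b -
            L⁻¹ ^ 2 * (↑(starB (blockUnion (k + 1) X₂)) : Set (PBond P 0)).indicator (fun b => Tloc (Qes f) b) b +
            Hloc ((↑S : Set (PBond P (0 + k))).indicator A') b +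
            ((TkF P hd w η (0 + k) (curl 1 ((↑S : Set (PBond P (0 + k))).indicator A')) b -
                Tloc (curl 1 ((↑S : Set (PBond P (0 + k))).indicator A')) b) +
              (HkF P w η (0 + k) ((↑S : Set (PBond P (0 + k))).indicator A') b -
                Hloc ((↑S : Set (PBond P (0 + k))).indicator A') b))) : ℝ) : ℂ)) :=
  eq5410_torus (by omega) hη X hu v g L (TkF P hd w η (0 + k)) Tloc (HkF P w η (0 + k)) Hloc (CkF P hd w η (0 + k))
    (eq541_base0 hd (by omega) hη hw) Qes f X₂ hX₂ hT S hrange b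

end Literature.MathematicalPhysics.QuantumFieldTheory.BalabanImbrieJaffe1984to88.BIJ88Eq541Base0
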